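import Literature.AlgebraicGeometry.Resolution.LocalBlowup
import Mathlib.RingTheory.IntegralClosure.IsIntegralClosure.Basic
import Mathlib.Algebra.Ring.Aut
import HarnessLib

/-!
# A normal local model is the canonical model of anything it is integral over; Galois stability

Topic: `Literature/AlgebraicGeometry/Resolution`. PROOF side of `CossartPiltant2019ReductionP`
(`ArithmeticalThreefoldsLocal.lean`), eighth brick of its one remaining input (C4) — descent of
local uniformization below the ramification field. Cossart–Piltant 2019, Def. 4.12: "Given a
normal local model `B_P` of `O_w|R`, we define a normal local model `B′` of `O_{w′}|R` by localizing
the integral closure `B̄` of `B` in `L′` at `P′ := 𝔪_{w′} ∩ B̄` … Note that if `B′` is a normal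
local model of `O_{w′}|R` then `B′ ∩ L = B′^{Gal(L′|L)}` is a normal local model of `O_w|R`"; the
tame descent step (p. 397, and [CoP1] Lemma 9.4: "`S` is stable by `G`") works with a REGULAR such
`B′ = Bʳ` ("a suitable r.s.p. of `Bʳ`"), i.e. it needs the given local uniformization upstairs to
be one of these canonical, Galois-stable models. This file proves the criterion behind that, in
the tree's currency (`locAtCentre`, `LocalBlowup.lean`):

* `locAtCentre_le_of_forall_isIntegral` — PROVED: if every element of `C ⊆ O` is integral over
  the local ring `T = T₀_{𝔪_O ∩ T₀}` and `T` is integrally closed in the field, then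
  `C_{𝔪_O ∩ C} ⊆ T` (domination: elements of value `0` of `T` are units of `T`).
* `locAtCentre_integralClosure_eq` — PROVED: if moreover `B ⊆ T` and `T₀` is integral over `B`,
  then `T` IS the canonical model: `T = (B̄)_{𝔪_O ∩ B̄}`, `B̄` the integral closure of `B` in the
  field.
* `apply_mem_locAtCentre_of_fixed` — PROVED, the stability criterion: consequently every field
  automorphism `σ` preserving `O` and fixing `B` pointwise maps `T` into itself.

Everything is PROVED; no named facts are introduced.

## Sources

* V. Cossart, O. Piltant, *Resolution of singularities of arithmetical threefolds*, J. Algebra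
  529 (2019) 268–535: Def. 4.12, Prop. 4.13 and the proof of Prop. 4.10, p. 397.
  [CossartPiltant2019]
* V. Cossart, O. Piltant, J. Algebra 320 (2008) 1051–1082: proof of Lemma 9.4 (HAL
  hal-00139124 p. 29, "`S` is stable by `G`"). [CossartPiltant2008]
-/

noncomputable section

namespace Literature.AlgebraicGeometry.Resolution

universe u

section CanonicalModel

variable {E : Type u} [Field E] (O : ValuationSubring E)

/-- **A dominated, integrally closed local ring contains the local ring at the centre of anything
integral over it**: if `T = T₀_{𝔪_O ∩ T₀}` is integrally closed in `E` and every
element of the subring `C` is integral over `T`, then `C_{𝔪_O ∩ C} ⊆ T` (a denominator of value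
`0` is a unit of `T`). [cite: CossartPiltant2019, Def. 4.12 (normal local models `B′ = B̄_{P′}`)] -/
theorem locAtCentre_le_of_forall_isIntegral {T₀ C : Subring E}
    (hic : ∀ z : E, IsIntegral (locAtCentre T₀ O) z → z ∈ locAtCentre T₀ O)
    (hC : ∀ c ∈ C, IsIntegral (locAtCentre T₀ O) c) :
    locAtCentre C O ≤ locAtCentre T₀ O := by
  have hCT : C ≤ locAtCentre T₀ O := fun c hc => hic c (hC c hc)
  calc locAtCentre C O ≤ locAtCentre (locAtCentre T₀ O) O := locAtCentre_mono O hCT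
    _ = locAtCentre T₀ O := locAtCentre_locAtCentre T₀ O

/-- Integrality over a smaller subring gives integrality over a larger one. [folklore] -/
private theorem isIntegral_of_le {B T : Subring E} (hBT : B ≤ T) {x : E} (hx : IsIntegral B x) :
    IsIntegral T x := by
  obtain ⟨p, hp, hpx⟩ := hx
  refine ⟨p.map (Subring.inclusion hBT), hp.map _, ?_⟩
  rw [Polynomial.eval₂_map]
  have : (algebraMap T E).comp (Subring.inclusion hBT) = algebraMap B E := RingHom.ext fun _ => rfl
  rw [this, hpx]

/-- **A normal dominated local ring is the canonical model of anything it is integral over**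
(Cossart–Piltant 2019, Def. 4.12: `B′ := B̄_{𝔪_{w′} ∩ B̄}`): let `T = T₀_{𝔪_O ∩ T₀}`
be integrally closed in `E`, `B ⊆ T` a subring over which every element of `T₀` is integral.
Then `T = B̄_{𝔪_O ∩ B̄}`, where `B̄` is the integral closure of `B` in `E`. Proof: `⊇` by
`locAtCentre_le_of_forall_isIntegral`; `⊆` since `T₀ ⊆ B̄`.
[cite: CossartPiltant2019, Def. 4.12 and proof of Prop. 4.10 p. 397 ("a suitable r.s.p. of `Bʳ`")] -/
theorem locAtCentre_integralClosure_eq {T₀ : Subring E}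
    (hic : ∀ z : E, IsIntegral (locAtCentre T₀ O) z → z ∈ locAtCentre T₀ O)
    (B : Subring E) (hBT : B ≤ locAtCentre T₀ O) (hint : ∀ x ∈ T₀, IsIntegral B x) :
    locAtCentre (integralClosure B E).toSubring O = locAtCentre T₀ O := by
  apply le_antisymm
  · refine locAtCentre_le_of_forall_isIntegral O hic fun c hc => ?_
    have hc' : c ∈ integralClosure B E := Subalgebra.mem_toSubring.mp hc
    exact isIntegral_of_le hBT hc'
  · exact locAtCentre_mono O fun x hx =>
      Subalgebra.mem_toSubring.mpr (show x ∈ integralClosure B E from hint x hx)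

variable (σ : E ≃+* E)

/-- An automorphism preserving a valuation ring preserves value `0` (`O.valuation z = 1`).
[folklore] -/
private theorem valuation_apply_eq_one' (hO : ∀ x ∈ O, σ x ∈ O) {z : E}
    (hz : O.valuation z = 1) : O.valuation (σ z) = 1 := by
  have hz0 : z ≠ 0 := ne_zero_of_valuation_eq_one hz
  have hzO : z ∈ O := (O.valuation_le_one_iff z).mp hz.le
  have hziO : z⁻¹ ∈ O := (O.valuation_le_one_iff _).mp (by rw [map_inv₀, hz, inv_one])
  have h1 : O.valuation (σ z) ≤ 1 := (O.valuation_le_one_iff _).mpr (hO z hzO)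
  have h2 : O.valuation (σ z)⁻¹ ≤ 1 := by
    rw [← map_inv₀ σ]
    exact (O.valuation_le_one_iff _).mpr (hO _ hziO)
  rw [map_inv₀] at h2
  have hσz0 : O.valuation (σ z) ≠ 0 := by
    rw [ne_eq, map_eq_zero]
    exact (map_ne_zero σ).mpr hz0
  exact le_antisymm h1 ((inv_le_one₀ (zero_lt_iff.mpr hσz0)).mp h2)

/-- An automorphism fixing `B` pointwise preserves integrality over `B`. [folklore] -/
private theorem isIntegral_apply_of_fixed {B : Subring E} (hB : ∀ b ∈ B, σ b = b) {x : E}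
    (hx : IsIntegral B x) : IsIntegral B (σ x) := by
  obtain ⟨p, hp, hpx⟩ := hx
  refine ⟨p, hp, ?_⟩
  have hcomp : (σ : E →+* E).comp (algebraMap B E) = algebraMap B E := by
    ext b
    exact hB b b.2
  have h := congrArg (σ : E →+* E) hpx
  rw [map_zero, Polynomial.hom_eval₂, hcomp] at h
  exact h

/-- **Galois stability of normal dominated local rings** (the criterion behind "`S` is stable
by `G`" in [CoP1] Lemma 9.4 and "`B′ ∩ L = B′^{Gal(L′|L)}`", Cossart–Piltant 2019 Def. 4.12): if
`T = T₀_{𝔪_O ∩ T₀}` is integrally closed in `E` and contains a subring `B` over which `T₀` is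
integral, then every automorphism `σ` of `E` preserving `O` and fixing `B` pointwise maps `T`
into itself — because `T = B̄_{𝔪_O ∩ B̄}` (`locAtCentre_integralClosure_eq`) and `σ` preserves
`B̄`, `O` and the elements of value `0`.
[cite: CossartPiltant2019, Def. 4.12 and proof of Prop. 4.10 p. 397] [cite: CossartPiltant2008, proof of Lemma 9.4 (HAL p. 29)] -/
theorem apply_mem_locAtCentre_of_fixed {T₀ : Subring E}
    (hic : ∀ z : E, IsIntegral (locAtCentre T₀ O) z → z ∈ locAtCentre T₀ O)
    (B : Subring E) (hBT : B ≤ locAtCentre T₀ O) (hint : ∀ x ∈ T₀, IsIntegral B x)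
    (hO : ∀ x ∈ O, σ x ∈ O) (hB : ∀ b ∈ B, σ b = b)
    {x : E} (hx : x ∈ locAtCentre T₀ O) : σ x ∈ locAtCentre T₀ O := by
  rw [← locAtCentre_integralClosure_eq O hic B hBT hint] at hx ⊢
  obtain ⟨y, hy, z, hz, hvz, rfl⟩ := mem_locAtCentre_iff.mp hx
  have hy' : σ y ∈ (integralClosure B E).toSubring :=
    Subalgebra.mem_toSubring.mpr (show IsIntegral B (σ y) from
      isIntegral_apply_of_fixed σ hB (Subalgebra.mem_toSubring.mp hy))
  have hz' : σ z ∈ (integralClosure B E).toSubring :=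
    Subalgebra.mem_toSubring.mpr (show IsIntegral B (σ z) from
      isIntegral_apply_of_fixed σ hB (Subalgebra.mem_toSubring.mp hz))
  exact mem_locAtCentre_iff.mpr ⟨σ y, hy', σ z, hz', valuation_apply_eq_one' O σ hO hvz,
    by rw [map_div₀]⟩

end CanonicalModel

end Literature.AlgebraicGeometry.Resolution

end
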